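import Summits.BirchSwinnertonDyer.BirchSwinnertonDyer.Theses.ToricShedding
import Literature.NumberTheory.EllipticCurves.HeegnerPointReflectionHolds
import Literature.NumberTheory.EllipticCurves.HeegnerPointsModularityProofs
import Literature.NumberTheory.EllipticCurves.LeadingTermHeegnerProofs
import Literature.NumberTheory.EllipticCurves.SelmerCorankHolds
import Literature.NumberTheory.EllipticCurves.BSDSelmerParityDokchitserProofs
import Literature.NumberTheory.EllipticCurves.BSDSelmerParityDokchitserBaseChangeProofs
import Literature.NumberTheory.EllipticCurves.QuadraticTwistSelmerPInfty
import Literature.NumberTheory.EllipticCurves.LFunctionSmulProofs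
import Literature.NumberTheory.EllipticCurves.PAdicBSD
import Literature.NumberTheory.EllipticCurves.ModularParametrizationProofs
import Literature.NumberTheory.EllipticCurves.ModularParametrizationHoldsProofs
import HarnessLib

/-!
# Crux-ideate sketch (round 1, ideator k = 1) for `TwistRankLeOne` (stmt-BirchSwinnertonDyer-15880)

Crux (route `ToricShedding`, decl by name):
`∀ V elliptic /ℚ, ∀ p prime, r_an(V) ≤ 1 → r_an(V) ≤ corank_{ℤ_p} Sel_{p^∞}(V/ℚ)`.

Two levers, one first lemma each.

* **Idea A `existence-half`** — the Selmer-side reading needs only the EXISTENCE half of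
  Gross–Zagier–Kolyvagin: for `r_an = 1`, `w = -1`, a Waldspurger twist gives a Heegner field `K`
  with `ord L(E/K) = 1`, Gross–Zagier makes `P_K` non-torsion, Darmon's Prop. 3.11 (PROVED in the
  tree) puts `P_K` in `E(ℚ)` up to torsion, so `rank E(ℚ) ≥ 1`, and Greenberg's identity (PROVED)
  gives `corank ≥ rank ≥ 1`. No Kolyvagin, no Murty–Murty, no `Ш`. Inputs: BCDT Thm A form (6)
  (`nonempty_modularParametrizationData`: modularity-`L` AND `K`-rational Heegner points),
  Waldspurger's twist, the Gross–Zagier formula. PROVED below, sorry-free: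
  `twistRankLeOne_of_existenceHalf`.
* **Idea B `heegner-field-oddness`** — parity over the Heegner field instead of a point: for odd
  `p`, `rk_p(E/M₀)` is odd for every Heegner field `M₀` (Dokchitser–Dokchitser 2010 §4.6 step (4):
  anticyclotomic tower + regulator constants), `rk_p(E/M₀) = rk_p(E) + rk_p(E^{d})` (PROVED), and
  Kato kills `rk_p(E^{d})` for the Waldspurger twist (`L(E^d,1) ≠ 0`); `p = 2` is Monsky. No
  height, no Gross–Zagier formula, no Heegner point in any statement. PROVED below, sorry-free:
  `twistRankLeOne_of_heegnerFieldOddness`.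
-/

set_option linter.dupNamespace false

noncomputable section

open scoped Classical

namespace Summit.BirchSwinnertonDyer.BirchSwinnertonDyer.Cruxes.TwistRankLeOne.IdeasR1K1

open Summit.BirchSwinnertonDyer.BirchSwinnertonDyer.Theses.ToricShedding (TwistRankLeOne)
open Literature.NumberTheory.EllipticCurves
open Literature.NumberTheory.EllipticCurves.ModularForms
open WeierstrassCurve WeierstrassCurve.QuadraticDescent

/-! ## Common bookkeeping: the rank-one slice and the Greenberg step -/

/-- The crux from its `r_an = 1` slice on globally minimal models: `r_an = 0` is trivial,
isomorphism invariance of `analyticRank` / `selmerCorank` moves to a global minimal model. [folklore] -/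
theorem twistRankLeOne_of_rankOne_minimal
    (h : ∀ (W : WeierstrassCurve ℚ) [W.IsElliptic] [W.IsGloballyMinimal] (p : ℕ) [Fact p.Prime],
      W.analyticRank = 1 → 1 ≤ W.selmerCorank p) :
    TwistRankLeOne := by
  intro V _ p _ hle
  rcases Nat.le_one_iff_eq_zero_or_eq_one.mp hle with h0 | h1
  · rw [h0]; exact Nat.zero_le _
  · obtain ⟨C, hC⟩ := hasGlobalMinimalModel_rat_holds V
    haveI := hC
    have han : (C • V).analyticRank = V.analyticRank := analyticRank_smul V C
    have hsel : V.selmerCorank p = (C • V).selmerCorank p :=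
      selmerCorank_eq_of_variableChange p (V := C) (W₁ := V) (W₂ := C • V) rfl
    rw [h1, hsel]
    exact h (C • V) p (by rw [han, h1])

/-- Greenberg: `rank ≤ corank` (PROVED identity `corank = rank + corank Ш`). [folklore] -/
theorem mordellWeilRank_le_selmerCorank (W : WeierstrassCurve ℚ) [W.IsElliptic] (p : ℕ)
    [Fact p.Prime] : W.mordellWeilRank ≤ W.selmerCorank p := by
  rw [W.selmerCorank_eq_mordellWeilRank_add_holds p]
  exact Nat.le_add_right _ _

/-! ## Idea A — existence half (FIRST LEMMA, proved) -/

/-- **First lemma of idea A.** On a globally minimal model, `r_an = 1 ⇒ rank E(ℚ) ≥ 1` from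
BCDT (6), Waldspurger and Gross–Zagier ONLY (Kolyvagin-free, Murty–Murty-free): the `r = 1`
branch of the tree's `rank_eq_analyticRank_of_isGloballyMinimal_of_heegnerPoint`, with the Heegner
field taken from Waldspurger alone and Prop. 3.11 / Atkin–Lehner / Hecke supplied by the tree.
[cite: GrossZagierInvent1986, Thm. I.6.3 and V.§2] -/
theorem one_le_mordellWeilRank_of_analyticRank_eq_one_of_existenceHalf
    (h₆ : nonempty_modularParametrizationData)
    (hWa : waldspurger_exists_heegnerField_twist_ne_zero)
    (hGZ : ∀ (N : ℕ) [NeZero N] (W : WeierstrassCurve ℚ) (K : Type) [Field K] [NumberField K],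
      gross_zagier N W K)
    (W : WeierstrassCurve ℚ) [W.IsElliptic] [W.IsGloballyMinimal] (h1 : W.analyticRank = 1) :
    1 ≤ W.mordellWeilRank := by
  haveI : NeZero (W.conductorNorm ℤ) := ⟨(W.conductorNorm_pos_holds).ne'⟩
  have hmod : existsUnique_isNewformOf :=
    existsUnique_isNewformOf_iff.mpr (exists_isNewformOf_of_nonempty_modularParametrizationData h₆)
  have hE : hasEntireLFunction_rat := hasEntireLFunction_rat_of_modularity hmod
  have hpar : W.even_analyticRank_iff :=
    W.even_analyticRank_iff_of hE
      (W.hasFunctionalEquationSign_rootNumber_of_modularity hmod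
        (fun N _ ↦ (isNewform0_exists_functional_equation_two_and N).1)
        (fun N _ ↦ (isNewform0_exists_functional_equation_two_and N).2))
  -- the sign is `-1`
  have hw : W.rootNumber = -1 := by
    rcases W.rootNumber_eq_one_or with hw | hw
    · exact absurd (hpar.mpr hw) (by rw [h1]; exact Nat.not_even_one)
    · exact hw
  -- Waldspurger: a Heegner field with `L(E^{(d_K)}, 1) ≠ 0`, so `ord L(E/K) = 1`
  obtain ⟨K, _, _, hKq, hH, hL'⟩ := hWa.exists W hw
  have hd : (NumberField.discr K : ℚ) ≠ 0 := by exact_mod_cast NumberField.discr_ne_zero K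
  haveI := W.isElliptic_quadraticTwist hd
  have htw : (W.quadraticTwist (NumberField.discr K : ℚ)).analyticRank = 0 :=
    ((W.quadraticTwist (NumberField.discr K : ℚ)).analyticRank_eq_zero_iff_holds (hE _)).mpr hL'
  have hr : analyticRankEK W K = 1 := by rw [analyticRankEK_eq_add_of hE, h1, htw]
  have hL : LDerivEK W K ≠ 0 := LDerivEK_ne_zero_of_analyticRankEK_eq_one W K hr
  -- BCDT (6): the Heegner point over `K`; Gross–Zagier: it is non-torsion
  obtain ⟨P, hP⟩ := exists_isHeegnerPoint_of_nonempty_modularParametrizationData W K h₆ hKq hH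
  have hPnt : ¬ IsOfFinAddOrder P :=
    not_isOfFinAddOrder_of_isHeegnerPoint_of_LDerivEK_ne_zero (hGZ _ W K hKq hH) hP hL
  -- Prop. 3.11 (PROVED): `σ P - P` is torsion since `w = -1`; descend
  obtain ⟨θ, c, hθ, hc⟩ :=
    Literature.NumberTheory.QuadraticFields.Quadratic.exists_sq_eq_algebraMap (F := ℚ) (K := K) hKq.1
  have hσ : Literature.NumberTheory.QuadraticFields.Quadratic.conj hKq.1 hθ hc ≠ AlgHom.id ℚ K := by
    intro hid
    have e1 : Literature.NumberTheory.QuadraticFields.Quadratic.conj hKq.1 hθ hc θ = -θ :=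
      Literature.NumberTheory.QuadraticFields.Quadratic.conj_gen hKq.1 hθ hc
    rw [hid, AlgHom.id_apply] at e1
    have h2θ : (2 : K) * θ = 0 := by linear_combination e1
    exact Literature.NumberTheory.QuadraticFields.Quadratic.ne_zero_of_not_mem_range hθ
      ((mul_eq_zero.mp h2θ).resolve_left two_ne_zero)
  have hT := heegnerPoint_conj_add_rootNumber_smul_holds W K hKq hH hP _ hσ
  rw [hw, neg_one_zsmul, ← sub_eq_add_neg] at hT
  exact one_le_mordellWeilRank_of_conjMap_sub_isOfFinAddOrder hKq.1 W W.module_finite_point_holds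
    hσ hPnt hT

/-- **Idea A concludes the crux BY NAME** from three printed inputs (BCDT (6), Waldspurger 1985,
Gross–Zagier 1986), sorry-free: Greenberg's identity turns `rank ≥ 1` into `corank ≥ 1`. [folklore] -/
theorem twistRankLeOne_of_existenceHalf
    (h₆ : nonempty_modularParametrizationData)
    (hWa : waldspurger_exists_heegnerField_twist_ne_zero)
    (hGZ : ∀ (N : ℕ) [NeZero N] (W : WeierstrassCurve ℚ) (K : Type) [Field K] [NumberField K],
      gross_zagier N W K) :
    TwistRankLeOne :=
  twistRankLeOne_of_rankOne_minimal fun W _ _ p _ h1 ↦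
    (one_le_mordellWeilRank_of_analyticRank_eq_one_of_existenceHalf h₆ hWa hGZ W h1).trans
      (mordellWeilRank_le_selmerCorank W p)

/-- **Idea A from three verbatim printed theorems**: modularity "Version `a_p`"
(`exists_isNewformOf`, BCDT 2001 Thm. A (2)), Waldspurger 1985 Thm. 5, Gross–Zagier 1986 Thm. I.6.3 —
BCDT's form (6) being a tree theorem from (2) (`nonempty_modularParametrizationData_of_modularity` with
the landed `IsNewformOf.exists_maninConstant_modularDegree_holds`). [folklore] -/
theorem twistRankLeOne_of_existenceHalf'
    (hmod : exists_isNewformOf)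
    (hWa : waldspurger_exists_heegnerField_twist_ne_zero)
    (hGZ : ∀ (N : ℕ) [NeZero N] (W : WeierstrassCurve ℚ) (K : Type) [Field K] [NumberField K],
      gross_zagier N W K) :
    TwistRankLeOne :=
  twistRankLeOne_of_existenceHalf
    (nonempty_modularParametrizationData_of_modularity hmod
      IsNewformOf.exists_maninConstant_modularDegree_holds) hWa hGZ

/-! ## Idea B — parity over the Heegner field (FIRST LEMMA, proved) -/

/-- **First lemma of idea B (odd `p`).** On a globally minimal model, `r_an = 1 ⇒ corank_p` odd
for odd `p`, from modularity, Waldspurger, Kato's `r_an = 0` finiteness (for the twist) and the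
Dokchitsers' oddness of `rk_p(E/M₀)` over a Heegner field; base-change additivity of the corank
and the corank of a finite group are PROVED in the tree. No Gross–Zagier, no height, no point.
[cite: DokchitserDokchitserAnnals2010, §4.6, proof of Thm. 4.19] -/
theorem odd_selmerCorank_of_analyticRank_eq_one_of_heegnerFieldOddness
    (hmod : existsUnique_isNewformOf)
    (hWa : waldspurger_exists_heegnerField_twist_ne_zero)
    (hKato : ∀ (W : WeierstrassCurve ℚ) [W.IsElliptic] [W.IsGloballyMinimal] (p : ℕ) [Fact p.Prime],
      kato_finite_of_L_one_ne_zero W p)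
    (hDD : dokchitser_selmerCorank_baseChange_mod_two_eq)
    (W : WeierstrassCurve ℚ) [W.IsElliptic] [W.IsGloballyMinimal] (p : ℕ) [Fact p.Prime]
    (hp : p ≠ 2) (h1 : W.analyticRank = 1) : W.selmerCorank p % 2 = 1 := by
  have hE : hasEntireLFunction_rat := hasEntireLFunction_rat_of_modularity hmod
  have hpar : W.even_analyticRank_iff :=
    W.even_analyticRank_iff_of hE
      (W.hasFunctionalEquationSign_rootNumber_of_modularity hmod
        (fun N _ ↦ (isNewform0_exists_functional_equation_two_and N).1)
        (fun N _ ↦ (isNewform0_exists_functional_equation_two_and N).2))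
  have hw : W.rootNumber = -1 := by
    rcases W.rootNumber_eq_one_or with hw | hw
    · exact absurd (hpar.mpr hw) (by rw [h1]; exact Nat.not_even_one)
    · exact hw
  obtain ⟨K, _, _, hKq, hH, hL'⟩ := hWa.exists W hw
  have hd : (NumberField.discr K : ℚ) ≠ 0 := by exact_mod_cast NumberField.discr_ne_zero K
  haveI := W.isElliptic_quadraticTwist hd
  set T := W.quadraticTwist (NumberField.discr K : ℚ) with hTdef
  -- Kato on a global minimal model of the twist: `Sel_{p^∞}(E^d/ℚ)` finite, corank `0`
  have hT0 : T.selmerCorank p = 0 := by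
    obtain ⟨C, hC⟩ := hasGlobalMinimalModel_rat_holds T
    haveI := hC
    have hLC : (C • T).entireLFunction 1 ≠ 0 := by rwa [entireLFunction_smul T C]
    obtain ⟨-, -, hfin⟩ := hKato (C • T) p hLC
    rw [selmerCorank_eq_of_variableChange p (V := C) (W₁ := T) (W₂ := C • T) rfl]
    haveI := hfin
    exact zpCorank_eq_zero_of_finite _ p
  -- Dokchitser–Dokchitser over the Heegner field, and base-change additivity (PROVED)
  have hodd : (W.baseChange K).selmerCorank p % 2 = 1 := hDD W p hp K hKq hH
  have hadd := selmerCorank_baseChange_quadratic_holds W K hKq.1 p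
  rw [hadd, ← hTdef, hT0, add_zero] at hodd
  exact hodd

/-- **Idea B concludes the crux BY NAME**, sorry-free, from modularity, Waldspurger, Kato (bsd.S20),
the Dokchitsers' Heegner-field oddness (bsd.S19 step (4)) and Monsky (`p = 2`). [folklore] -/
theorem twistRankLeOne_of_heegnerFieldOddness
    (hmod : existsUnique_isNewformOf)
    (hWa : waldspurger_exists_heegnerField_twist_ne_zero)
    (hKato : ∀ (W : WeierstrassCurve ℚ) [W.IsElliptic] [W.IsGloballyMinimal] (p : ℕ) [Fact p.Prime],
      kato_finite_of_L_one_ne_zero W p)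
    (hDD : dokchitser_selmerCorank_baseChange_mod_two_eq)
    (hMon : monsky_selmerCorank_two_mod_two_eq) :
    TwistRankLeOne := by
  refine twistRankLeOne_of_rankOne_minimal fun W _ _ p _ h1 ↦ ?_
  by_cases hp : p = 2
  · subst hp
    have h := hMon W
    rw [h1] at h
    omega
  · have h := odd_selmerCorank_of_analyticRank_eq_one_of_heegnerFieldOddness hmod hWa hKato hDD W p
      hp h1
    omega

end Summit.BirchSwinnertonDyer.BirchSwinnertonDyer.Cruxes.TwistRankLeOne.IdeasR1K1

end
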